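import Mathlib
import Literature.NumberTheory.GaloisRepresentations.AbsGaloisOuterConj
import Literature.NumberTheory.GaloisRepresentations.SatakeFamilyOfFramedGaloisRep
import Literature.NumberTheory.GaloisRepresentations.HeckeCharacterGaloisAvatarProofs
import Literature.NumberTheory.GaloisRepresentations.HeckeCharacterOfRayClass
import Literature.NumberTheory.GaloisRepresentations.FramedRepTwist
import Literature.NumberTheory.GaloisRepresentations.TwistedSumAssembly
import Literature.NumberTheory.GaloisRepresentations.GaloisRepFrobeniusProofs
import Literature.NumberTheory.Automorphic.SelfdualGL3AdjointLiftProofs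
import Literature.NumberTheory.Automorphic.AutomorphicRepsGLSatakeFlathProofs
import Literature.NumberTheory.Automorphic.ChebotarevArtinRepHolds
import Literature.RepresentationTheory.Semisimple.BrauerNesbitt
import Summits.Langlands.Langlands.Theorems.TwistUnpackaging.Negative.TwistSeparationOrder

/-!
# Assembly of the crux conclusion from a matching `τ`-halving — stub `stub_assembly` of line
kummer-chebotarev-separating-twists (crux TwistUnpackaging, stmt-Langlands-10903)

Let `F/F₀` be a quadratic extension of number fields with non-trivial automorphism `τ`, `t ∈ Γ_{F₀}`
a lift of `τ` (`absGaloisQuot F₀ F t = τ`, so `θ := absGaloisOuterConj F₀ F t` is "conjugation by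
`τ`" on `Γ_F`), `π` a cuspidal automorphic representation of `GL_n(𝔸_F)`, `ι : ℚ̄_ℓ ≃ ℂ`, and `G`
a cofinite `τ`-stable set of finite places of `F` at which `π` has the Satake parameter `αf w`.
Write `S_w` for the roots of the predicted polynomial `arithFrobPolyOfSatake ι q_w n (αf w)`.
Suppose `A : Γ_F → GL_{2n}(ℚ̄_ℓ)` is semisimple, unramified on `G` with Frobenius roots
`S_w + S_{τ w}`, and `ρ : Γ_F → GL_n(ℚ̄_ℓ)` is a semisimple `τ`-halving of `A`
(`charpoly A(g) = charpoly ρ(g) · charpoly ρ(θ g)`) whose Frobenius roots are `S_w` at every split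
place `w ∈ G` (`τ w ≠ w`).  Then for almost every `w` and every Satake parameter `α` of `π` at `w`,
`ρ` is unramified at `w` with Frobenius characteristic polynomial `arithFrobPolyOfSatake ι q_w n α`
(`stub_assembly`, the conclusion of the crux `TwistUnpackaging`).

Proof.
1. *Unramifiedness of the summand.*  By the Brauer–Nesbitt theorem
   (`Literature.RepresentationTheory.Semisimple.Representation.nonempty_equiv_of_charpoly_eq`) the
   semisimple representations `A` and `ρ ⊕ ρ^θ` with the same characteristic polynomials are
   equivalent, so an element killed by `A` (an element of an inertia group above `w ∈ G`) is killed
   by `ρ` (`FramedRep.apply_eq_one_of_charpoly_eq_mul`).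
2. *Split places.*  `charpoly ρ(σ)` and the predicted polynomial are monic with the same roots over
   the algebraically closed field `ℚ̄_ℓ`, hence equal (`eq_of_monic_of_roots_eq`).
3. *Inert places* (`τ w = w`).  For an arithmetic Frobenius `σ` at `𝔓 ∣ w`, `θ σ` is an arithmetic
   Frobenius at `τ ⋆ 𝔓 ∣ τ w = w` (`isArithFrobAt_absGaloisOuterConj_iff`,
   `outerConjIdeal_mem_primesAbove`); `ρ` being unramified at `w`, `charpoly ρ(θ σ) = charpoly ρ(σ)`
   (`GaloisRep.IsUnramifiedAt.hasFrobCharpolyAt_charpoly`), so `roots ρ(σ) + roots ρ(σ) = S_w + S_w`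
   and `roots ρ(σ) = S_w` (halving of multisets).
4. Cofiniteness of `G` and uniqueness of Satake parameters
   (`AutomorphicRepData.hasSatakeParamAt_unique_holds`).

References: Serre, *Abelian ℓ-adic representations* (1968), Ch. I §2; Bourbaki, *Algèbre* VIII
§ 20 n° 6 (Brauer–Nesbitt); Harris–Taylor (2001), proof of Thm. VII.1.9 (the descent pattern).
-/

set_option linter.dupNamespace false -- project-wide option (lakefile weak.linter.dupNamespace); `Summit.Langlands.Langlands` is the mandated namespace

open Literature.NumberTheory.GaloisRepresentations Literature.NumberTheory.Automorphic
open IsDedekindDomain NumberField Filter Polynomial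

namespace Summit.Langlands.Langlands.Theorems.TwistUnpackaging.KummerChebotarev

/-! ### General lemmas -/

/-- Halving of multisets: `X + X = S + S` forces `X = S` (compare multiplicities). [folklore] -/
theorem multiset_eq_of_add_self_eq {β : Type*} {X S : Multiset β} (h : X + X = S + S) : X = S := by
  classical
  ext a
  have := congrArg (Multiset.count a) h
  simp only [Multiset.count_add] at this
  omega

/-- Over an algebraically closed field, two monic polynomials with the same roots (with
multiplicity) are equal: both are the product of `X - r` over their roots
(Mathlib `Polynomial.prod_multiset_X_sub_C_of_monic_of_roots_card_eq`,
`IsAlgClosed.card_roots_eq_natDegree`). [folklore] -/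
theorem eq_of_monic_of_roots_eq {k : Type*} [Field k] [IsAlgClosed k] {p q : k[X]} (hp : p.Monic)
    (hq : q.Monic) (h : p.roots = q.roots) : p = q :=
  calc p = (p.roots.map fun a ↦ X - C a).prod :=
        (prod_multiset_X_sub_C_of_monic_of_roots_card_eq hp IsAlgClosed.card_roots_eq_natDegree).symm
    _ = (q.roots.map fun a ↦ X - C a).prod := by rw [h]
    _ = q := prod_multiset_X_sub_C_of_monic_of_roots_card_eq hq IsAlgClosed.card_roots_eq_natDegree

/-- The predicted Frobenius polynomial `arithFrobPolyOfSatake ι q m α` is monic (a product of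
monic linear factors). [folklore] -/
theorem monic_arithFrobPolyOfSatake {ℓ : ℕ} [Fact ℓ.Prime] (ι : PadicAlgCl ℓ ≃+* ℂ) (q m : ℕ)
    (α : Multiset ℂ) : (arithFrobPolyOfSatake ι q m α).Monic := by
  unfold arithFrobPolyOfSatake
  exact monic_multiset_prod_of_monic _ _ fun a _ ↦ monic_X_sub_C _

/-- **A semisimple summand of a semisimple representation is killed by what kills the sum.**
If `A`, `ρ₁`, `ρ₂` are framed representations of a group `G` over a field `k` with semisimple
underlying representations and `charpoly A(g) = charpoly ρ₁(g) · charpoly ρ₂(g)` for all `g`, then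
`A(g) = 1` implies `ρ₁(g) = 1`: by the Brauer–Nesbitt theorem
(`Literature.RepresentationTheory.Semisimple.Representation.nonempty_equiv_of_charpoly_eq`, Bourbaki,
*Algèbre* VIII § 20 n° 6, Cor. 1) `A ≅ ρ₁ ⊕ ρ₂` (`Representation.prod`, semisimple by
`Representation.isSemisimpleRepresentation_prod`, characteristic polynomials by
`LinearMap.charpoly_prodMap`), and an equivalence carries `A(g) = 1` to `ρ₁(g) ⊕ ρ₂(g) = 1`.
[folklore] -/
theorem FramedRep.apply_eq_one_of_charpoly_eq_mul {G : Type*} [Group G] [TopologicalSpace G]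
    {k : Type*} [Field k] [TopologicalSpace k] {N n₁ n₂ : ℕ} (A : FramedRep G k N)
    (ρ₁ : FramedRep G k n₁) (ρ₂ : FramedRep G k n₂)
    (hA : A.toRepresentation.IsSemisimpleRepresentation)
    (h₁ : ρ₁.toRepresentation.IsSemisimpleRepresentation)
    (h₂ : ρ₂.toRepresentation.IsSemisimpleRepresentation)
    (h : ∀ g : G, FramedRep.charpoly A g = FramedRep.charpoly ρ₁ g * FramedRep.charpoly ρ₂ g)
    {g : G} (hg : A g = 1) : ρ₁ g = 1 := by
  haveI := hA; haveI := h₁; haveI := h₂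
  have hchar : ∀ x : G, (A.toRepresentation x).charpoly =
      ((ρ₁.toRepresentation.prod ρ₂.toRepresentation) x).charpoly := by
    intro x
    change _ = ((ρ₁.toRepresentation x).prodMap (ρ₂.toRepresentation x)).charpoly
    rw [LinearMap.charpoly_prodMap, ← FramedRep.charpoly_eq_charpoly_toRepresentation,
      ← FramedRep.charpoly_eq_charpoly_toRepresentation,
      ← FramedRep.charpoly_eq_charpoly_toRepresentation]
    exact h x
  obtain ⟨e⟩ :=
    Literature.RepresentationTheory.Semisimple.Representation.nonempty_equiv_of_charpoly_eq
      A.toRepresentation (ρ₁.toRepresentation.prod ρ₂.toRepresentation) hchar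
  have hAg : A.toRepresentation g = LinearMap.id := by
    rw [FramedRep.toRepresentation_apply_eq_toLin', hg, Units.val_one, Matrix.toLin'_one]
  have hprod : (ρ₁.toRepresentation.prod ρ₂.toRepresentation) g = LinearMap.id := by
    rw [← Representation.Equiv.conj_apply_self g e, hAg, LinearEquiv.conj_id]
  have hρ : ρ₁.toRepresentation g = LinearMap.id := by
    refine LinearMap.ext fun v ↦ ?_
    have := congr($hprod (v, 0))
    exact congrArg Prod.fst this
  have h2 : Matrix.toLin' ((ρ₁ g : GL (Fin n₁) k) : Matrix (Fin n₁) (Fin n₁) k) =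
      Matrix.toLin' 1 := by
    rw [Matrix.toLin'_one, ← FramedRep.toRepresentation_apply_eq_toLin']
    exact hρ
  exact Units.ext (Matrix.toLin'.injective h2)

/-- **At an unramified place all arithmetic Frobenii have the same characteristic polynomial**
(framed form of the accepted `GaloisRep.IsUnramifiedAt.hasFrobCharpolyAt_charpoly`, through
`isUnramifiedAt_toGaloisRep_iff` / `hasFrobCharpolyAt_toGaloisRep_iff`): if `ρ : Γ_K → GL_n(A)` is
unramified at `v` and `σ`, `σ'` are arithmetic Frobenii at primes `𝔓, 𝔓' ∣ v`, then
`charpoly ρ(σ') = charpoly ρ(σ)`.  Serre, *Abelian ℓ-adic representations* (1968), Ch. I §2.1.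
[folklore] -/
theorem FramedGaloisRep.IsUnramifiedAt.charpoly_eq {K : Type} [Field K] [NumberField K]
    {A : Type*} [CommRing A] [TopologicalSpace A] [IsTopologicalRing A] {n : ℕ}
    {v : HeightOneSpectrum (𝓞 K)} {ρ : FramedGaloisRep K A n} (h : ρ.IsUnramifiedAt v)
    {𝔓 𝔓' : Ideal (absIntegers (𝓞 K) K)} (h𝔓 : 𝔓 ∈ v.primesAbove) (h𝔓' : 𝔓' ∈ v.primesAbove)
    {σ σ' : Field.absoluteGaloisGroup K} (hσ : IsArithFrobAt (𝓞 K) σ 𝔓)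
    (hσ' : IsArithFrobAt (𝓞 K) σ' 𝔓') :
    FramedRep.charpoly ρ σ' = FramedRep.charpoly ρ σ := by
  have hQ : ρ.HasFrobCharpolyAt v (ρ.toGaloisRep σ).charpoly :=
    (FramedGaloisRep.hasFrobCharpolyAt_toGaloisRep_iff v _ ρ).mp
      (((FramedGaloisRep.isUnramifiedAt_toGaloisRep_iff v ρ).mpr h).hasFrobCharpolyAt_charpoly
        h𝔓 hσ)
  rw [hQ 𝔓 h𝔓 σ hσ, hQ 𝔓' h𝔓' σ' hσ']

/-! ### The stub -/

/-- **Stub F — assembly of the crux conclusion from a matching `τ`-halving.**  `G` a cofinite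
`τ`-stable set of places at which `π` has the Satake parameter `αf w` and `A` (unramified at `w`) has
Frobenius roots `S_w + S_{τw}` (`S_w` = roots of `arithFrobPolyOfSatake ι q_w n (αf w)`); `ρ` a
semisimple `τ`-halving of the semisimple `A` whose Frobenius roots are `S_w` at every SPLIT place of
`G` (`τ • w ≠ w`).  Then `ρ` is unramified with `HasFrobCharpolyAt w (arithFrobPolyOfSatake ι q_w n α)`
for almost every `w` and every Satake parameter `α` of `π` at `w`.  Proof: `ρ ⊕ ρ^θ ≅ A`
(Brauer–Nesbitt) so `ρ(I_w) = 1` where `A(I_w) = 1` (`FramedRep.apply_eq_one_of_charpoly_eq_mul`);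
at split `w` the monic degree-`n` `charpoly ρ σ` with the roots of the (monic, split) predicted
polynomial equals it (`eq_of_monic_of_roots_eq`); at inert `w` (`τ • w = w`) `θ σ` is again a
Frobenius above `w` (`isArithFrobAt_absGaloisOuterConj_iff`, `outerConjIdeal_mem_primesAbove`), `ρ`
is unramified there, so `roots ρ σ + roots ρ σ = S_w + S_w` (`FramedGaloisRep.IsUnramifiedAt.charpoly_eq`,
`Polynomial.roots_mul`) and `multiset_eq_of_add_self_eq`; finally cofiniteness of `G` and uniqueness
of Satake parameters (`AutomorphicRepData.hasSatakeParamAt_unique_holds`). [folklore] -/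
theorem stub_assembly :
    ∀ (F₀ F : Type) [Field F₀] [NumberField F₀] [Field F] [NumberField F] [Algebra F₀ F]
      [IsGalois F₀ F] (τ : F ≃ₐ[F₀] F), Module.finrank F₀ F = 2 → τ ≠ 1 →
    ∀ (t : Field.absoluteGaloisGroup F₀), absGaloisQuot F₀ F t = τ →
    ∀ (n : ℕ) (hcpt : isCompact_glFiniteIntegralLevel n F) (π : CuspidalAutomorphicRepData n F hcpt)
      (ℓ : ℕ) [Fact ℓ.Prime] (ι : PadicAlgCl ℓ ≃+* ℂ)
      (αf : HeightOneSpectrum (𝓞 F) → Multiset ℂ) (G : Set (HeightOneSpectrum (𝓞 F)))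
      (A : FramedGaloisRep F (PadicAlgCl ℓ) (2 * n)) (ρ : FramedGaloisRep F (PadicAlgCl ℓ) n),
      (∀ᶠ w in Filter.cofinite, w ∈ G) →
      (∀ w ∈ G, τ • w ∈ G ∧ π.1.HasSatakeParamAt w (αf w)) →
      (∀ w ∈ G, A.IsUnramifiedAt w ∧
        ∀ 𝔓 ∈ w.primesAbove, ∀ σ : Field.absoluteGaloisGroup F, IsArithFrobAt (𝓞 F) σ 𝔓 →
          (FramedRep.charpoly A σ).roots =
            (arithFrobPolyOfSatake ι w.residueCard n (αf w)).roots +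
            (arithFrobPolyOfSatake ι (τ • w).residueCard n (αf (τ • w))).roots) →
      A.toGaloisRep.IsSemisimple → ρ.toGaloisRep.IsSemisimple →
      (∀ g : Field.absoluteGaloisGroup F, FramedRep.charpoly A g =
          FramedRep.charpoly ρ g * FramedRep.charpoly ρ (absGaloisOuterConj F₀ F t g)) →
      (∀ w ∈ G, τ • w ≠ w → ∀ 𝔓 ∈ w.primesAbove, ∀ σ : Field.absoluteGaloisGroup F,
          IsArithFrobAt (𝓞 F) σ 𝔓 →
          (FramedRep.charpoly ρ σ).roots = (arithFrobPolyOfSatake ι w.residueCard n (αf w)).roots) →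
    ∀ᶠ w in Filter.cofinite, ∀ α : Multiset ℂ, π.1.HasSatakeParamAt w α →
      ρ.IsUnramifiedAt w ∧ ρ.HasFrobCharpolyAt w (arithFrobPolyOfSatake ι w.residueCard n α) := by
  intro F₀ F _ _ _ _ _ _ τ _hdeg _hτ t ht n hcpt π ℓ _ ι αf G A ρ hG hGτ hA hAss hρss hsplit hmatch
  -- (1) `ρ` is unramified on `G`: `A ≅ ρ ⊕ ρ^θ` (Brauer–Nesbitt) and `A` kills the inertia groups.
  have hθss : (ρ.outerConj t).toGaloisRep.IsSemisimple :=
    (FramedGaloisRep.isSemisimple_outerConj_iff t ρ).2 hρss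
  have hsplit' : ∀ g : Field.absoluteGaloisGroup F, FramedRep.charpoly A g =
      FramedRep.charpoly ρ g * FramedRep.charpoly (ρ.outerConj t) g := fun g ↦ by
    rw [FramedGaloisRep.charpoly_outerConj]
    exact hsplit g
  have hunr : ∀ w ∈ G, ρ.IsUnramifiedAt w := by
    intro w hw 𝔓 h𝔓 σ hσ
    exact FramedRep.apply_eq_one_of_charpoly_eq_mul A ρ (ρ.outerConj t) hAss hρss hθss hsplit'
      ((hA w hw).1 𝔓 h𝔓 σ hσ)
  -- (2)+(3) the Frobenius roots of `ρ` at every place of `G` (split: hypothesis; inert: halving).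
  have hroots : ∀ w ∈ G, ∀ 𝔓 ∈ w.primesAbove, ∀ σ : Field.absoluteGaloisGroup F,
      IsArithFrobAt (𝓞 F) σ 𝔓 →
      (FramedRep.charpoly ρ σ).roots = (arithFrobPolyOfSatake ι w.residueCard n (αf w)).roots := by
    intro w hw 𝔓 h𝔓 σ hσ
    by_cases hτw : τ • w = w
    · have h𝔓' : outerConjIdeal t 𝔓 ∈ w.primesAbove := by
        have hmem := outerConjIdeal_mem_primesAbove h𝔓 t
        rwa [ht, hτw] at hmem
      have hσ' : IsArithFrobAt (𝓞 F) (absGaloisOuterConj F₀ F t σ) (outerConjIdeal t 𝔓) :=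
        (isArithFrobAt_absGaloisOuterConj_iff h𝔓 t σ).2 hσ
      have hc : FramedRep.charpoly ρ (absGaloisOuterConj F₀ F t σ) = FramedRep.charpoly ρ σ :=
        FramedGaloisRep.IsUnramifiedAt.charpoly_eq (hunr w hw) h𝔓 h𝔓' hσ hσ'
      have hAσ := (hA w hw).2 𝔓 h𝔓 σ hσ
      have hne : FramedRep.charpoly ρ σ * FramedRep.charpoly ρ σ ≠ 0 :=
        mul_ne_zero (Matrix.charpoly_monic _).ne_zero (Matrix.charpoly_monic _).ne_zero
      rw [hτw, hsplit σ, hc, roots_mul hne] at hAσ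
      exact multiset_eq_of_add_self_eq hAσ
    · exact hmatch w hw hτw 𝔓 h𝔓 σ hσ
  -- (4) cofiniteness of `G` and uniqueness of Satake parameters.
  filter_upwards [hG] with w hw α hα
  obtain rfl : α = αf w := π.1.hasSatakeParamAt_unique_holds hα (hGτ w hw).2
  refine ⟨hunr w hw, ?_⟩
  intro 𝔓 h𝔓 σ hσ
  exact eq_of_monic_of_roots_eq (Matrix.charpoly_monic _) (monic_arithFrobPolyOfSatake ι _ n _)
    (hroots w hw 𝔓 h𝔓 σ hσ)

end Summit.Langlands.Langlands.Theorems.TwistUnpackaging.KummerChebotarev
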